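import Literature.Analysis.PDE.CoordWordTame
import Literature.Analysis.PDE.SobolevTupleSpace
import Mathlib.MeasureTheory.Integral.Marginal
import Mathlib.MeasureTheory.Integral.IntegralEqImproper
import Mathlib.MeasureTheory.Measure.Haar.InnerProductSpace
import Mathlib.Analysis.Calculus.BumpFunction.FiniteDimension
import Mathlib.Data.Set.Finite.List
import Mathlib.Analysis.Calculus.Deriv.Pi
import HarnessLib

/-!
# Sup bounds by the fundamental theorem of calculus: `‖φ(x)‖ ≤ ∫ ‖∂_{i₁} ⋯ ∂_{iₙ} φ‖`, and the
# pointwise control of smooth jets by the `H^s` norm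

Function-space layer of the energy-method programme for short-time existence of quasilinear
strictly parabolic second-order systems on a closed manifold (hypothesis `hQL` of
`Literature.Geometry.Riemannian.ricciFlow_shortTime_existence_of_quasilinear`). Pointwise values
of (derivatives of) the maps in the Sobolev tuple spaces `𝐇_s` (`SobolevTupleSpace.lean`) are
controlled by the crude, dimension-uniform Sobolev inequality obtained by integrating once in
every coordinate (the first step of the Gagliardo–Nirenberg–Sobolev inequality, Evans, *PDE*,
§5.6.1, proof of Thm. 1: "`|u(x)| ≤ ∫ |Du(x₁, …, yᵢ, …, xₙ)| dyᵢ`", iterated over `i = 1, …, n`):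

* `enorm_le_lmarginal_cpdList` / `enorm_le_lintegral_cwd` — for a smooth compactly supported
  `φ : ℝⁿ → F` and a list `l` enumerating the coordinates once,
  `‖φ(x)‖ ≤ ∫ ‖∂_l φ‖` (Mathlib's one-variable `HasCompactSupport.enorm_le_lintegral_Ici_deriv`
  and the marginal-integral calculus `MeasureTheory.lmarginal`, transported from `ι → ℝ` to
  `EuclideanSpace ℝ ι` by the volume-preserving `toLp`);
* `norm_le_mul_eLpNorm_cwd` — hence `‖φ(x)‖ ≤ vol(K)^{1/2} ‖∂_l φ‖_{L²}` when `tsupport φ ⊆ K`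
  (Cauchy–Schwarz), a loss of exactly `n = dim` derivatives, no fractional exponents;
* `norm_jetL_smul_le` — multiplication by a fixed smooth compactly supported cut-off `θ` is
  bounded on smooth jets: `‖jetL s (θ • u)‖ ≤ C_θ ‖jetL s u‖` (Leibniz over splittings);
* `exists_norm_cwd_le_norm_jetL` — **the pointwise bound**: for `m + n ≤ s` and a cut-off `θ`
  there is `C` with `‖∂_v u_k (x)‖ ≤ C ‖jetL s u‖` for all smooth compactly supported tuples `u`,
  `|v| ≤ m`, and all `x` near which `θ = 1`;
* `exists_norm_cwd_sub_le_norm_jetL` — **the equi-Lipschitz bound**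
  `‖∂_v u_k (x) - ∂_v u_k (x')‖ ≤ C ‖jetL s u‖ ‖x - x'‖` on a convex set near which `θ = 1`,
  for `m + 1 + n ≤ s` (mean value inequality).

Everything is proved; no named fact and no `sorry` is introduced.

## References

* L. C. Evans, *Partial Differential Equations*, 2nd ed., AMS 2010, §5.6.1 (proof of Thm. 1,
  first display) and §5.6.3 (general Sobolev inequalities, `W^{k,p} ⊂ C^{k-[n/p]-1,γ}`).
  [Evans2010]
* R. A. Adams, *Sobolev Spaces*, Academic Press 1975, Lemma 5.15 and Thm. 5.4 (Case C).
  [Adams1975]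
-/

noncomputable section

open MeasureTheory Set Function Filter
open scoped ContDiff Topology RealInnerProductSpace ENNReal

namespace Literature.Analysis.PDE

open Literature.Analysis.FunctionSpaces

variable {ι : Type*} [Fintype ι] [DecidableEq ι]
variable {F : Type*} [NormedAddCommGroup F] [NormedSpace ℝ F]

/-! ### Coordinate partial derivatives on `ι → ℝ` and the iterated fundamental theorem -/

/-- Iterated coordinate partial derivatives on `ι → ℝ` along a list of indices (head =
outermost): the tree's `iterDirDeriv` along the vectors `Pi.single i 1`. [folklore] -/
def cpdList (l : List ι) (u : (ι → ℝ) → F) : (ι → ℝ) → F :=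
  iterDirDeriv (l.map fun i => (Pi.single i (1 : ℝ) : ι → ℝ)) u

/-- Unfolding at a cons. [folklore] -/
theorem cpdList_cons (i : ι) (l : List ι) (u : (ι → ℝ) → F) :
    cpdList (i :: l) u = fun y => fderiv ℝ (cpdList l u) y (Pi.single i 1) := rfl

/-- No derivative. [folklore] -/
@[simp]
theorem cpdList_nil (u : (ι → ℝ) → F) : cpdList ([] : List ι) u = u := rfl

/-- Smoothness of `cpdList`. [folklore] -/
theorem contDiff_cpdList {u : (ι → ℝ) → F} (hu : ContDiff ℝ ∞ u) (l : List ι) :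
    ContDiff ℝ ∞ (cpdList l u) :=
  contDiff_iterDirDeriv hu _

/-- Compact support of `cpdList`. [folklore] -/
theorem hasCompactSupport_cpdList {u : (ι → ℝ) → F} (hu : HasCompactSupport u) (l : List ι) :
    HasCompactSupport (cpdList l u) :=
  hasCompactSupport_iterDirDeriv hu _

/-- **One coordinate**: `‖g y‖ ≤ ∫ ‖∂_i g (y₁, …, t, …, yₙ)‖ dt` for smooth compactly supported `g`
(the fundamental theorem of calculus in the `i`-th variable; Evans, §5.6.1, proof of Thm. 1,
first display). [cite: Evans2010, §5.6.1, proof of Thm. 1] -/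
theorem enorm_le_lintegral_update {g : (ι → ℝ) → F} (hg : ContDiff ℝ ∞ g)
    (hgc : HasCompactSupport g) (y : ι → ℝ) (i : ι) :
    ‖g y‖ₑ ≤ ∫⁻ t, ‖fderiv ℝ g (update y i t) (Pi.single i 1)‖ₑ := by
  have h1 : ContDiff ℝ 1 (g ∘ update y i) :=
    (hg.of_le (by norm_cast)).comp (contDiff_update 1 y i)
  have h2 : HasCompactSupport (g ∘ update y i) :=
    hgc.comp_isClosedEmbedding (isClosedEmbedding_update y i)
  have h3 := HasCompactSupport.enorm_le_lintegral_Ici_deriv h1 h2 (y i)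
  rw [Function.comp_apply, update_eq_self] at h3
  refine h3.trans ((lintegral_mono' Measure.restrict_le_self le_rfl).trans (lintegral_mono ?_))
  intro t
  show ‖deriv (g ∘ update y i) t‖ₑ ≤ ‖fderiv ℝ g (update y i t) (Pi.single i 1)‖ₑ
  rw [fderiv_comp_deriv _ ((hg.differentiable (by simp)) _) (hasDerivAt_update y i t).differentiableAt,
    deriv_update]

/-- **Iterated fundamental theorem of calculus**: for a list `l` of distinct coordinates,
`‖u x‖ ≤ (∫⋯∫_{l} ‖∂_l u‖) x` (marginal integral over the coordinates in `l`).
[cite: Evans2010, §5.6.1, proof of Thm. 1] -/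
theorem enorm_le_lmarginal_cpdList {u : (ι → ℝ) → F} (hu : ContDiff ℝ ∞ u)
    (huc : HasCompactSupport u) {l : List ι} (hl : l.Nodup) (x : ι → ℝ) :
    ‖u x‖ₑ ≤ (∫⋯∫⁻_l.toFinset, (fun y => ‖cpdList l u y‖ₑ) ∂(fun _ : ι => (volume : Measure ℝ))) x := by
  induction l generalizing x with
  | nil => simp only [List.toFinset_nil, lmarginal_empty, cpdList_nil]; exact le_rfl
  | cons i l ih =>
    rw [List.nodup_cons] at hl
    obtain ⟨hi, hl'⟩ := hl
    have hi' : i ∉ l.toFinset := fun h => hi (List.mem_toFinset.1 h)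
    have hmeas : Measurable fun y => ‖cpdList (i :: l) u y‖ₑ :=
      (continuous_enorm.comp (contDiff_cpdList hu (i :: l)).continuous).measurable
    rw [List.toFinset_cons, lmarginal_insert' _ hmeas hi']
    refine (ih hl' x).trans (lmarginal_mono (fun y => ?_) x)
    have h := enorm_le_lintegral_update (contDiff_cpdList hu l) (hasCompactSupport_cpdList huc l) y i
    simpa only [cpdList_cons] using h

/-- **All coordinates**: for a list `l` enumerating `ι` without repetition,
`‖u x‖ ≤ ∫ ‖∂_l u‖` over `ι → ℝ`. [cite: Evans2010, §5.6.1, proof of Thm. 1] -/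
theorem enorm_le_lintegral_cpdList {u : (ι → ℝ) → F} (hu : ContDiff ℝ ∞ u)
    (huc : HasCompactSupport u) {l : List ι} (hl : l.Nodup) (hl' : l.toFinset = Finset.univ)
    (x : ι → ℝ) :
    ‖u x‖ₑ ≤ ∫⁻ y, ‖cpdList l u y‖ₑ := by
  have h := enorm_le_lmarginal_cpdList hu huc hl x
  rw [hl', lmarginal_univ] at h
  simpa [volume_pi] using h

/-! ### Transport to `EuclideanSpace ℝ ι` -/

omit [Fintype ι] [DecidableEq ι] in
/-- The coordinate map `toLp : (ι → ℝ) → EuclideanSpace ℝ ι` as a continuous linear map.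
[folklore] -/
theorem hasFDerivAt_toLp (y : ι → ℝ) :
    HasFDerivAt (fun z : ι → ℝ => (WithLp.toLp 2 z : EuclideanSpace ℝ ι))
      ((PiLp.continuousLinearEquiv 2 ℝ (fun _ : ι => ℝ)).symm : (ι → ℝ) →L[ℝ] EuclideanSpace ℝ ι)
        y :=
  ((PiLp.continuousLinearEquiv 2 ℝ (fun _ : ι => ℝ)).symm : (ι → ℝ) →L[ℝ] EuclideanSpace ℝ ι)
    |>.hasFDerivAt

/-- Coordinate partial derivatives of `φ ∘ toLp` are the word derivatives of `φ`:
`cpdList l (φ ∘ toLp) = (cwd l φ) ∘ toLp`. [folklore] -/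
theorem cpdList_comp_toLp {φ : EuclideanSpace ℝ ι → F} (hφ : ContDiff ℝ ∞ φ) (l : List ι) :
    cpdList l (fun y => φ (WithLp.toLp 2 y)) = fun y => cwd l φ (WithLp.toLp 2 y) := by
  induction l with
  | nil => rfl
  | cons i l ih =>
    funext y
    rw [cpdList_cons]
    change fderiv ℝ (cpdList l fun y => φ (WithLp.toLp 2 y)) y (Pi.single i 1) =
      cwd (i :: l) φ (WithLp.toLp 2 y)
    rw [ih, cwd_cons]
    have hd : DifferentiableAt ℝ (cwd l φ) (WithLp.toLp 2 y) := differentiable_cwd hφ l _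
    have hc : HasFDerivAt (fun z : ι → ℝ => cwd l φ (WithLp.toLp 2 z))
        ((fderiv ℝ (cwd l φ) (WithLp.toLp 2 y)).comp
          ((PiLp.continuousLinearEquiv 2 ℝ (fun _ : ι => ℝ)).symm :
            (ι → ℝ) →L[ℝ] EuclideanSpace ℝ ι)) y :=
      hd.hasFDerivAt.comp y (hasFDerivAt_toLp y)
    rw [hc.fderiv, ContinuousLinearMap.comp_apply]
    congr 1
    rw [bv_eq_single]
    rfl

omit [DecidableEq ι] [NormedSpace ℝ F] in
/-- Measurability glue: `x ↦ ‖f x‖ₑ` is measurable for continuous `f`. [folklore] -/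
theorem measurable_enorm_comp_toLp {f : EuclideanSpace ℝ ι → F} (hf : Continuous f) :
    Measurable fun x : EuclideanSpace ℝ ι => ‖f x‖ₑ :=
  (continuous_enorm.comp hf).measurable

/-- **The sup bound on `EuclideanSpace`**: `‖φ x‖ ≤ ∫ ‖∂_l φ‖` for smooth compactly supported `φ`
and a list `l` enumerating the coordinates once. [cite: Evans2010, §5.6.1, proof of Thm. 1] -/
theorem enorm_le_lintegral_cwd {φ : EuclideanSpace ℝ ι → F} (hφ : ContDiff ℝ ∞ φ)
    (hφc : HasCompactSupport φ) {l : List ι} (hl : l.Nodup) (hl' : l.toFinset = Finset.univ)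
    (x : EuclideanSpace ℝ ι) :
    ‖φ x‖ₑ ≤ ∫⁻ y, ‖cwd l φ y‖ₑ := by
  have hu : ContDiff ℝ ∞ fun y : ι → ℝ => φ (WithLp.toLp 2 y) :=
    hφ.comp (PiLp.continuousLinearEquiv 2 ℝ (fun _ : ι => ℝ)).symm.contDiff
  have huc : HasCompactSupport fun y : ι → ℝ => φ (WithLp.toLp 2 y) :=
    hφc.comp_homeomorph ((PiLp.continuousLinearEquiv 2 ℝ (fun _ : ι => ℝ)).symm.toHomeomorph)
  have h := enorm_le_lintegral_cpdList hu huc hl hl' (WithLp.ofLp x)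
  rw [cpdList_comp_toLp hφ] at h
  simp only [WithLp.toLp_ofLp] at h
  refine h.trans_eq ?_
  exact (PiLp.volume_preserving_toLp ι).lintegral_comp (measurable_enorm_comp_toLp
    (continuous_cwd hφ l))

/-- There is a list enumerating the coordinates once, of length `Fintype.card ι`. [folklore] -/
theorem exists_list_nodup_toFinset_eq_univ :
    ∃ l : List ι, l.Nodup ∧ l.toFinset = Finset.univ ∧ l.length = Fintype.card ι :=
  ⟨Finset.univ.toList, Finset.univ.nodup_toList, Finset.univ.toList_toFinset,
    by rw [Finset.length_toList]; rfl⟩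

/-! ### From `L¹` to `L²` on a compact support -/

omit [DecidableEq ι] [NormedSpace ℝ F] in
/-- **Cauchy–Schwarz on the support**: if `f` vanishes off the compact set `K` then
`∫ ‖f‖ ≤ vol(K)^{1/2} ‖f‖_{L²}`. [folklore] -/
theorem lintegral_enorm_le_of_support {f : EuclideanSpace ℝ ι → F} (hf : Continuous f)
    {K : Set (EuclideanSpace ℝ ι)} (hK : IsCompact K) (hfK : ∀ x, x ∉ K → f x = 0) :
    ∫⁻ x, ‖f x‖ₑ ≤ (volume K) ^ (1 / 2 : ℝ) * eLpNorm f 2 (volume : Measure (EuclideanSpace ℝ ι)) := by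
  have hind : (fun x => ‖f x‖ₑ) = fun x => K.indicator (fun _ => (1 : ℝ≥0∞)) x * ‖f x‖ₑ := by
    funext x
    by_cases hx : x ∈ K
    · rw [indicator_of_mem hx, one_mul]
    · rw [indicator_of_notMem hx, hfK x hx]; simp
  rw [hind]
  have h := ENNReal.lintegral_mul_le_Lp_mul_Lq (volume : Measure (EuclideanSpace ℝ ι))
    (f := K.indicator fun _ => (1 : ℝ≥0∞)) (g := fun x => ‖f x‖ₑ)
    Real.HolderConjugate.two_two ((measurable_const.indicator hK.measurableSet).aemeasurable)
    (continuous_enorm.comp hf).measurable.aemeasurable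
  refine h.trans_eq ?_
  congr 1
  · rw [show (fun a => K.indicator (fun _ => (1 : ℝ≥0∞)) a ^ (2 : ℝ)) =
        K.indicator (fun _ => (1 : ℝ≥0∞)) from by
      funext a; by_cases ha : a ∈ K <;> simp [ha]]
    rw [lintegral_indicator hK.measurableSet, setLIntegral_const, one_mul]
  · rw [eLpNorm_eq_lintegral_rpow_enorm_toReal (by norm_num) (by norm_num)]
    norm_num

/-- **The pointwise `L²` Sobolev bound with a loss of `n` derivatives**: for smooth `φ` with
`tsupport φ ⊆ K` compact and a list `l` enumerating the coordinates once,
`‖φ x‖ ≤ vol(K)^{1/2} ‖∂_l φ‖_{L²}`. [cite: Evans2010, §5.6.1 and §5.6.3] -/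
theorem norm_le_mul_eLpNorm_cwd {φ : EuclideanSpace ℝ ι → F} (hφ : ContDiff ℝ ∞ φ)
    {K : Set (EuclideanSpace ℝ ι)} (hK : IsCompact K) (hφK : tsupport φ ⊆ K) {l : List ι}
    (hl : l.Nodup) (hl' : l.toFinset = Finset.univ) (x : EuclideanSpace ℝ ι) :
    ‖φ x‖ ≤ ((volume K) ^ (1 / 2 : ℝ)).toReal *
      (eLpNorm (cwd l φ) 2 (volume : Measure (EuclideanSpace ℝ ι))).toReal := by
  have hφc : HasCompactSupport φ := HasCompactSupport.of_support_subset_isCompact hK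
    (subset_tsupport φ |>.trans hφK)
  have h1 := enorm_le_lintegral_cwd hφ hφc hl hl' x
  have hzero : ∀ y, y ∉ K → cwd l φ y = 0 := fun y hy =>
    image_eq_zero_of_notMem_tsupport fun h => hy (hφK (tsupport_cwd_subset l φ h))
  have h2 := lintegral_enorm_le_of_support (continuous_cwd hφ l) hK hzero
  have hfin1 : (volume K) ^ (1 / 2 : ℝ) ≠ ⊤ :=
    (ENNReal.rpow_lt_top_of_nonneg (by norm_num) hK.measure_lt_top.ne).ne
  have hmem : MemLp (cwd l φ) 2 (volume : Measure (EuclideanSpace ℝ ι)) :=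
    (continuous_cwd hφ l).memLp_of_hasCompactSupport (hasCompactSupport_cwd hφc l)
  have hfin2 : eLpNorm (cwd l φ) 2 (volume : Measure (EuclideanSpace ℝ ι)) ≠ ⊤ := hmem.eLpNorm_ne_top
  rw [← ENNReal.toReal_mul, ← ENNReal.ofReal_le_iff_le_toReal (ENNReal.mul_ne_top hfin1 hfin2),
    ofReal_norm]
  exact h1.trans h2

/-! ### Cut-offs act boundedly on smooth jets -/

section Cutoff

variable {W : Type*} [NormedAddCommGroup W] [InnerProductSpace ℝ W]
variable {N s : ℕ}

omit [DecidableEq ι] in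
/-- Multiplication of a smooth compactly supported tuple by a smooth scalar function stays in
`smoothCS`. [folklore] -/
theorem smul_mem_smoothCS {θ : EuclideanSpace ℝ ι → ℝ} (hθ : ContDiff ℝ ∞ θ)
    {u : Fin N → EuclideanSpace ℝ ι → W} (hu : u ∈ smoothCS W N ι) :
    (fun k x => θ x • u k x) ∈ smoothCS W N ι := fun k =>
  ⟨hθ.smul (hu k).1, (hu k).2.mono fun x hx h0 => hx (by change θ x • u k x = 0; rw [h0, smul_zero])⟩

/-- The cut-off tuple `θ • u` as an element of `smoothCS`. [folklore] -/
def smulCS {θ : EuclideanSpace ℝ ι → ℝ} (hθ : ContDiff ℝ ∞ θ) (u : smoothCS W N ι) :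
    smoothCS W N ι :=
  ⟨fun k x => θ x • u.1 k x, smul_mem_smoothCS hθ u.2⟩

omit [DecidableEq ι] in
/-- Components of `smulCS`. [folklore] -/
@[simp]
theorem smulCS_apply {θ : EuclideanSpace ℝ ι → ℝ} (hθ : ContDiff ℝ ∞ θ) (u : smoothCS W N ι)
    (k : Fin N) (x : EuclideanSpace ℝ ι) : (smulCS hθ u).1 k x = θ x • u.1 k x := rfl

omit [DecidableEq ι] in
/-- A smooth compactly supported function has all word derivatives of bounded length uniformly
bounded. [folklore] -/
theorem exists_bound_cwd_of_hasCompactSupport {θ : EuclideanSpace ℝ ι → ℝ} (hθ : ContDiff ℝ ∞ θ)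
    (hθc : HasCompactSupport θ) (m : ℕ) :
    ∃ M : ℝ, 0 ≤ M ∧ ∀ a : List ι, a.length ≤ m → ∀ x, ‖cwd a θ x‖ ≤ M := by
  -- finitely many words of length `≤ m`; each derivative is continuous with compact support
  have hfin : Set.Finite {a : List ι | a.length ≤ m} := List.finite_length_le ι m
  have hb : ∀ a : List ι, ∃ M : ℝ, ∀ x, ‖cwd a θ x‖ ≤ M := fun a =>
    (continuous_cwd hθ a).bounded_above_of_compact_support (hasCompactSupport_cwd hθc a) |> fun h =>
      by
        obtain ⟨M, hM⟩ := h
        exact ⟨M, fun x => hM x⟩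
  choose M hM using hb
  obtain ⟨B, hB⟩ := (hfin.image M).bddAbove
  refine ⟨max B 0, le_max_right _ _, fun a ha x => (hM a x).trans ?_⟩
  exact (hB ⟨a, ha, rfl⟩).trans (le_max_left _ _)

omit [DecidableEq ι] in
/-- **Cut-offs are bounded on smooth jets**: `‖jetL s (θ • u)‖ ≤ C ‖jetL s u‖`, `C` depending
only on `θ` and `s`. [cite: Adams1975, ¶3.1] -/
theorem exists_norm_jetL_smul_le {θ : EuclideanSpace ℝ ι → ℝ} (hθ : ContDiff ℝ ∞ θ)
    (hθc : HasCompactSupport θ) (s : ℕ) :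
    ∃ C : ℝ, 0 ≤ C ∧ ∀ u : smoothCS W N ι, ‖jetL s (smulCS hθ u)‖ ≤ C * ‖jetL s u‖ := by
  obtain ⟨M, hM0, hM⟩ := exists_bound_cwd_of_hasCompactSupport hθ hθc s
  -- the constant: each of the `2^s` Leibniz terms of each of the components
  set n₀ : ℕ := Fintype.card (Fin N × OWord ι s) with hn₀
  refine ⟨Real.sqrt n₀ * (2 ^ s * M), by positivity, fun u => ?_⟩
  set K : Set (EuclideanSpace ℝ ι) := tsupport θ with hK
  have hKc : IsCompact K := hθc
  -- each component of the cut-off jet is bounded in `L²` by `2^s M ‖jetL s u‖`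
  have hcomp : ∀ p : Fin N × OWord ι s,
      ∫ x, ‖owd p.2 ((smulCS hθ u).1 p.1) x‖ ^ 2 ≤ (2 ^ s * M * ‖jetL s u‖) ^ 2 := by
    intro p
    have huk : ContDiff ℝ ∞ (u.1 p.1) := (u.2 p.1).1
    -- Leibniz
    have hL := cwd_smul (F := W) hθ huk p.2.red
    have heq : (fun x => θ x • u.1 p.1 x) = (smulCS hθ u).1 p.1 := rfl
    rw [heq] at hL
    rw [owd_def, hL]
    -- `L²` norm of the Leibniz sum via `l2On K`
    have hterm : ∀ q ∈ splittings p.2.red,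
        l2On K (fun x => cwd q.1 θ x • cwd q.2 (u.1 p.1) x) ≤ M * ‖jetL s u‖ := by
      intro q hq
      have hlen := length_add_length_of_mem_splittings hq
      have hq1 : q.1.length ≤ s := by have := p.2.length_red_le; omega
      have hq2 : q.2.length ≤ s := by have := p.2.length_red_le; omega
      calc l2On K (fun x => cwd q.1 θ x • cwd q.2 (u.1 p.1) x)
          ≤ M * l2On K (cwd q.2 (u.1 p.1)) := by
            refine l2On_le_mul_of_le hKc (continuous_cwd huk q.2) hM0 fun x _ => ?_
            rw [norm_smul]
            exact mul_le_mul_of_nonneg_right (hM q.1 hq1 x) (norm_nonneg _)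
        _ ≤ M * ‖jetL s u‖ := by
            refine mul_le_mul_of_nonneg_left ?_ hM0
            refine le_trans ?_ (eLpNorm_cwd_le u p.1 hq2)
            rw [l2On_def]
            refine ENNReal.toReal_mono ?_ (eLpNorm_indicator_le _)
            exact ((continuous_cwd huk q.2).memLp_of_hasCompactSupport
              (hasCompactSupport_cwd (u.2 p.1).2 q.2)).eLpNorm_ne_top
    have hsum := l2On_list_sum_le hKc (splittings p.2.red)
      (φ := fun q x => cwd q.1 θ x • cwd q.2 (u.1 p.1) x)
      (fun q _ => (continuous_cwd hθ q.1).smul (continuous_cwd huk q.2))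
    have hsum' : l2On K (fun x => ((splittings p.2.red).map fun q =>
        cwd q.1 θ x • cwd q.2 (u.1 p.1) x).sum) ≤ 2 ^ s * M * ‖jetL s u‖ := by
      refine hsum.trans ?_
      calc ((splittings p.2.red).map fun q => l2On K fun x => cwd q.1 θ x • cwd q.2 (u.1 p.1) x).sum
          ≤ ((splittings p.2.red).map fun _ => M * ‖jetL s u‖).sum :=
            List.sum_le_sum fun q hq => hterm q hq
        _ = (splittings p.2.red).length * (M * ‖jetL s u‖) := by
            rw [List.map_const', List.sum_replicate, nsmul_eq_mul]
        _ ≤ 2 ^ s * (M * ‖jetL s u‖) := by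
            refine mul_le_mul_of_nonneg_right ?_ (by positivity)
            rw [length_splittings]
            exact_mod_cast Nat.pow_le_pow_right (by norm_num) p.2.length_red_le
        _ = 2 ^ s * M * ‖jetL s u‖ := by ring
    -- the Leibniz sum vanishes off `K`, so `l2On K` is the full `L²` norm, whose square is the integral
    set g : EuclideanSpace ℝ ι → W := fun x => ((splittings p.2.red).map fun q =>
      cwd q.1 θ x • cwd q.2 (u.1 p.1) x).sum with hg
    have hgc : Continuous g := continuous_list_sum _ fun q _ =>
      (continuous_cwd hθ q.1).smul (continuous_cwd huk q.2)
    have hgK : ∀ x, x ∉ K → g x = 0 := by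
      intro x hx
      simp only [hg]
      refine List.sum_eq_zero fun y hy => ?_
      obtain ⟨q, _, rfl⟩ := List.mem_map.1 hy
      have : cwd q.1 θ x = 0 :=
        image_eq_zero_of_notMem_tsupport fun h => hx (tsupport_cwd_subset q.1 θ h)
      rw [this, zero_smul]
    have hind : K.indicator g = g := by
      funext x
      by_cases hx : x ∈ K
      · rw [indicator_of_mem hx]
      · rw [indicator_of_notMem hx, hgK x hx]
    have hgcs : HasCompactSupport g :=
      HasCompactSupport.of_support_subset_isCompact hKc fun x hx => by
        by_contra hxK
        exact hx (hgK x hxK)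
    have hmem : MemLp g 2 (volume : Measure (EuclideanSpace ℝ ι)) :=
      hgc.memLp_of_hasCompactSupport hgcs
    have hl2 : l2On K g = (eLpNorm g 2 (volume : Measure (EuclideanSpace ℝ ι))).toReal := by
      rw [l2On_def, hind]
    have hsq : (eLpNorm g 2 (volume : Measure (EuclideanSpace ℝ ι))).toReal ^ 2 =
        ∫ x, ‖g x‖ ^ 2 := by
      rw [← Lp.norm_toLp g hmem, ← real_inner_self_eq_norm_sq, L2.inner_def]
      refine integral_congr_ae ?_
      filter_upwards [hmem.coeFn_toLp] with x hx
      rw [hx, real_inner_self_eq_norm_sq]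
    rw [← hsq, ← hl2]
    exact pow_le_pow_left₀ (l2On_nonneg K g) hsum' 2
  -- sum over the components
  have hsq := norm_jetL_sq (s := s) (smulCS hθ u)
  have hle : ‖jetL s (smulCS hθ u)‖ ^ 2 ≤ n₀ * (2 ^ s * M * ‖jetL s u‖) ^ 2 := by
    rw [hsq]
    calc ∑ p : Fin N × OWord ι s, ∫ x, ‖owd p.2 ((smulCS hθ u).1 p.1) x‖ ^ 2
        ≤ ∑ _p : Fin N × OWord ι s, (2 ^ s * M * ‖jetL s u‖) ^ 2 := Finset.sum_le_sum fun p _ => hcomp p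
      _ = n₀ * (2 ^ s * M * ‖jetL s u‖) ^ 2 := by rw [Finset.sum_const, nsmul_eq_mul]; rfl
  have h0 : 0 ≤ Real.sqrt n₀ * (2 ^ s * M) * ‖jetL s u‖ := by positivity
  refine (pow_le_pow_iff_left₀ (norm_nonneg _) h0 two_ne_zero).1 ?_
  calc ‖jetL s (smulCS hθ u)‖ ^ 2 ≤ n₀ * (2 ^ s * M * ‖jetL s u‖) ^ 2 := hle
    _ = (Real.sqrt n₀) ^ 2 * (2 ^ s * M * ‖jetL s u‖) ^ 2 := by
        rw [Real.sq_sqrt (Nat.cast_nonneg _)]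
    _ = (Real.sqrt n₀ * (2 ^ s * M) * ‖jetL s u‖) ^ 2 := by ring

end Cutoff

/-! ### Pointwise control of smooth jets by the `H^s` norm -/

section Pointwise

variable {W : Type*} [NormedAddCommGroup W] [InnerProductSpace ℝ W]
variable {N s : ℕ}

/-- **Pointwise bound for word derivatives of smooth jets**: given a smooth compactly supported
cut-off `θ` and orders with `m + dim ≤ s`, there is `C` such that
`‖∂_v u_k (x)‖ ≤ C ‖jetL s u‖` for all smooth compactly supported tuples `u`, all `k`, all words
`|v| ≤ m` and all points `x` near which `θ = 1` (Evans, §5.6.3, Thm. 6 in crude form).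
[cite: Evans2010, §5.6.3, Thm. 6] -/
theorem exists_norm_cwd_le_norm_jetL {θ : EuclideanSpace ℝ ι → ℝ} (hθ : ContDiff ℝ ∞ θ)
    (hθc : HasCompactSupport θ) {m : ℕ} (hms : m + Fintype.card ι ≤ s) :
    ∃ C : ℝ, 0 ≤ C ∧ ∀ u : smoothCS W N ι, ∀ k : Fin N, ∀ v : List ι, v.length ≤ m →
      ∀ x : EuclideanSpace ℝ ι, θ =ᶠ[𝓝 x] (fun _ => 1) → ‖cwd v (u.1 k) x‖ ≤ C * ‖jetL s u‖ := by
  obtain ⟨C₁, hC₁0, hC₁⟩ := exists_norm_jetL_smul_le (W := W) (N := N) hθ hθc s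
  obtain ⟨l, hl, hl', hlen⟩ := exists_list_nodup_toFinset_eq_univ (ι := ι)
  set K : Set (EuclideanSpace ℝ ι) := tsupport θ with hK
  have hKc : IsCompact K := hθc
  refine ⟨((volume K) ^ (1 / 2 : ℝ)).toReal * C₁, by positivity, fun u k v hv x hx => ?_⟩
  -- replace `u_k` by the cut-off map near `x`
  have huk : ContDiff ℝ ∞ (u.1 k) := (u.2 k).1
  have hθu : ContDiff ℝ ∞ ((smulCS hθ u).1 k) := ((smulCS hθ u).2 k).1
  have heq : cwd v (u.1 k) x = cwd v ((smulCS hθ u).1 k) x := by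
    have h1 : (u.1 k) =ᶠ[𝓝 x] ((smulCS hθ u).1 k) := by
      filter_upwards [hx] with y hy
      simp [smulCS_apply, hy]
    exact (eventuallyEq_cwd h1 v).eq_of_nhds
  rw [heq]
  -- the support of the cut-off map lies in `K`
  have hsupp : tsupport (cwd v ((smulCS hθ u).1 k)) ⊆ K := by
    refine (tsupport_cwd_subset v _).trans ?_
    refine closure_minimal ?_ (isClosed_tsupport θ)
    intro y hy
    rw [mem_support] at hy
    by_contra hyK
    apply hy
    have : θ y = 0 := image_eq_zero_of_notMem_tsupport hyK
    simp [smulCS_apply, this]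
  have h1 := norm_le_mul_eLpNorm_cwd (contDiff_cwd hθu v) hKc hsupp hl hl' x
  rw [← cwd_append] at h1
  have h2 : (eLpNorm (cwd (l ++ v) ((smulCS hθ u).1 k)) 2
      (volume : Measure (EuclideanSpace ℝ ι))).toReal ≤ ‖jetL s (smulCS hθ u)‖ :=
    eLpNorm_cwd_le (smulCS hθ u) k (by rw [List.length_append]; omega)
  calc ‖cwd v ((smulCS hθ u).1 k) x‖
      ≤ ((volume K) ^ (1 / 2 : ℝ)).toReal * (eLpNorm (cwd (l ++ v) ((smulCS hθ u).1 k)) 2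
          (volume : Measure (EuclideanSpace ℝ ι))).toReal := h1
    _ ≤ ((volume K) ^ (1 / 2 : ℝ)).toReal * ‖jetL s (smulCS hθ u)‖ :=
        mul_le_mul_of_nonneg_left h2 ENNReal.toReal_nonneg
    _ ≤ ((volume K) ^ (1 / 2 : ℝ)).toReal * (C₁ * ‖jetL s u‖) :=
        mul_le_mul_of_nonneg_left (hC₁ u) ENNReal.toReal_nonneg
    _ = ((volume K) ^ (1 / 2 : ℝ)).toReal * C₁ * ‖jetL s u‖ := by ring

omit [DecidableEq ι] in
/-- Operator norm through the frame: `‖L‖ ≤ Σᵢ ‖L 𝐞ᵢ‖` for `L : ℝⁿ →L F`. [folklore] -/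
theorem opNorm_le_sum_norm_apply_bv (L : EuclideanSpace ℝ ι →L[ℝ] F) :
    ‖L‖ ≤ ∑ i, ‖L (bv i)‖ := by
  refine ContinuousLinearMap.opNorm_le_bound _ (Finset.sum_nonneg fun i _ => norm_nonneg _)
    fun x => ?_
  have hx : x = ∑ i, x i • (bv i : EuclideanSpace ℝ ι) := by
    simpa [bv_def] using ((EuclideanSpace.basisFun ι ℝ).sum_repr x).symm
  calc ‖L x‖ = ‖∑ i, x i • L (bv i)‖ := by
        conv_lhs => rw [hx]
        simp [map_sum, map_smul]
    _ ≤ ∑ i, ‖x i • L (bv i)‖ := norm_sum_le _ _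
    _ ≤ ∑ i, ‖x‖ * ‖L (bv i)‖ := by
        refine Finset.sum_le_sum fun i _ => ?_
        rw [norm_smul]
        exact mul_le_mul_of_nonneg_right (by simpa using PiLp.norm_apply_le x i)
          (norm_nonneg _)
    _ = (∑ i, ‖L (bv i)‖) * ‖x‖ := by rw [Finset.sum_mul]; simp [mul_comm]

/-- **Equi-Lipschitz bound for word derivatives of smooth jets**: for `m + 1 + dim ≤ s`, a smooth
compactly supported cut-off `θ` and a convex set `Y` on a neighbourhood of which `θ = 1`, there
is `C` with `‖∂_v u_k (x) - ∂_v u_k (x')‖ ≤ C ‖jetL s u‖ ‖x - x'‖` for `x, x' ∈ Y`, `|v| ≤ m`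
(mean value inequality with the pointwise bound for one more derivative).
[cite: Evans2010, §5.6.3, Thm. 6] -/
theorem exists_norm_cwd_sub_le_norm_jetL {θ : EuclideanSpace ℝ ι → ℝ} (hθ : ContDiff ℝ ∞ θ)
    (hθc : HasCompactSupport θ) {m : ℕ} (hms : m + 1 + Fintype.card ι ≤ s)
    {Y : Set (EuclideanSpace ℝ ι)} (hY : Convex ℝ Y) (hθY : ∀ x ∈ Y, θ =ᶠ[𝓝 x] (fun _ => 1)) :
    ∃ C : ℝ, 0 ≤ C ∧ ∀ u : smoothCS W N ι, ∀ k : Fin N, ∀ v : List ι, v.length ≤ m →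
      ∀ x ∈ Y, ∀ x' ∈ Y, ‖cwd v (u.1 k) x - cwd v (u.1 k) x'‖ ≤ C * ‖jetL s u‖ * ‖x - x'‖ := by
  obtain ⟨C, hC0, hC⟩ := exists_norm_cwd_le_norm_jetL (W := W) (N := N) hθ hθc
    (m := m + 1) (by omega)
  refine ⟨Fintype.card ι * C, by positivity, fun u k v hv x hx x' hx' => ?_⟩
  have huk : ContDiff ℝ ∞ (u.1 k) := (u.2 k).1
  have hdiff : ∀ y ∈ Y, HasFDerivWithinAt (cwd v (u.1 k)) (fderiv ℝ (cwd v (u.1 k)) y) Y y :=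
    fun y _ => ((differentiable_cwd huk v) y).hasFDerivAt.hasFDerivWithinAt
  have hbound : ∀ y ∈ Y, ‖fderiv ℝ (cwd v (u.1 k)) y‖ ≤ Fintype.card ι * C * ‖jetL s u‖ := by
    intro y hy
    refine (opNorm_le_sum_norm_apply_bv _).trans ?_
    calc ∑ i, ‖fderiv ℝ (cwd v (u.1 k)) y (bv i)‖ ≤ ∑ _i : ι, C * ‖jetL s u‖ := by
          refine Finset.sum_le_sum fun i _ => ?_
          have h := hC u k (i :: v) (by simpa using hv) y (hθY y hy)
          simpa only [cwd_cons] using h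
      _ = Fintype.card ι * C * ‖jetL s u‖ := by
          rw [Finset.sum_const, nsmul_eq_mul, Finset.card_univ]; ring
  have h := hY.norm_image_sub_le_of_norm_hasFDerivWithin_le hdiff hbound hx' hx
  linarith [h]

end Pointwise

end Literature.Analysis.PDE

end
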